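import Summits.QuantumFields.QCD.Theorems.QuarksAsStableActionStableActionBridgeFockLiftPosDef
import Summits.QuantumFields.QCD.Theorems.HeatSlicedQuarksRobustYangMillsHandoverFilledSliceState
import Literature.MathematicalPhysics.QuantumLattice.HubbardModelParticleHoleProofs
import HarnessLib

/-!
# Particle–hole conjugation of the Fock functor: `P_h Γ(M) P_hᴴ = det M · Γ(M⁻ᵀ)`
(stub `stub_fockLift_complement` of line `twisted_trace_transfer` for crux
`QuarksAsStableAction.StableActionBridge`, item stmt-QuantumFields-9737, sub-goal Q2b₂)

On the fermionic Fock space `Fock ι = Finset ι → ℂ` of finitely many modes the line needs a unitary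
`P_h` supported on complements (`(P_h)_{t s} = 0` unless `t = sᶜ`) with

  `P_h Γ(M) P_hᴴ = det M · Γ((M⁻¹)ᵀ)`   for every invertible one-particle matrix `M`,

where `Γ = fockLift` (`QCDTransferMatrix`) is the second quantisation (matrix of minors).  This is the
exterior-algebra identity `⋆ Λᵏ(M) ⋆⁻¹ = det M · Λⁿ⁻ᵏ(M⁻ᵀ)` (Jacobi's complementary-minor theorem).

We take for `P_h` the tree's particle–hole transformation `particleHole 1` of `FermionOperators`
(`P |s⟩ = (∏_{i∈s} σ_i(ι)) |sᶜ⟩`, unitary, `P c†_a Pᴴ = c_a` — `HubbardModelParticleHoleProofs`) and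
prove the identity WITHOUT computing a single minor, by the cyclicity of the vacuum
(`eq_one_of_commute_creation_of_mulVec_vacuum`: an operator commuting with every `c†_j` and fixing
`|∅⟩` is `1`) applied to `Z = (det M)⁻¹ · Pᴴ Γ(Mᵀ) P Γ(M)`:
* `Γ(M) c†_j = c†(M e_j) Γ(M)` (`Gamma_mul_creation`), `P c†(f) Pᴴ = Σ fᵢ cᵢ`, and — the adjoint of
  the intertwining relation for `(Mᵀ)ᴴ` — `Γ(Mᵀ) (Σᵢ M_{ij} cᵢ) = c_j Γ(Mᵀ)`, `Pᴴ c_j P = c†_j`; so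
  `Z c†_j = c†_j Z`;
* `Γ(M)|∅⟩ = |∅⟩`, `P|∅⟩ = |ι⟩`, `Γ(Mᵀ)|ι⟩ = det M · |ι⟩` (top exterior power,
  `fockLift_mulVec_filled`), `Pᴴ|ι⟩ = |∅⟩`; so `Z|∅⟩ = |∅⟩`.
Hence `Pᴴ Γ(Mᵀ) P Γ(M) = det M · 1`, and with `Γ(M⁻ᵀ) Γ(Mᵀ) = Γ(1) = 1`, `P Pᴴ = 1` this is
`P Γ(M) Pᴴ = det M · Γ(M⁻ᵀ)`.  (`fockLift = Gamma` by `fockLift_eq_Gamma'`.)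

References: Bratteli–Robinson II §5.2.1–5.2.2 (second quantisation, CAR) [BratteliRobinsonII1997];
H. Tasaki, *Physics and Mathematics of Quantum Many-Body Systems* (2020) §9.3.3 (particle–hole map)
[Tasaki2020].  Pure theorem file (no definitions, no local notations).
-/

noncomputable section

open scoped Matrix BigOperators
open Literature.MathematicalPhysics.QuantumFieldTheory Literature.MathematicalPhysics.QuantumLattice
open Summit.QuantumFields.QCD.Cruxes.StableActionBridge.Sketch.FockLiftPosDef

namespace Summit.QuantumFields.QCD.Cruxes.StableActionBridge.TwistedTraceTransfer

namespace StubFockLiftComplement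

open Matrix Finset RayleighBound

/-- The constant phases `ε ≡ 1` are unimodular. [folklore] -/
theorem norm_constOne_eq_one {ι : Type*} : ∀ i : ι, ‖(fun _ : ι => (1 : ℂ)) i‖ = 1 :=
  fun _ => by simp

variable {ι : Type*} [LinearOrder ι] [Fintype ι]

/-- `P c†_a Pᴴ = c_a` for the phase-free particle–hole transformation `P = particleHole 1`.
[folklore] -/
theorem particleHole_one_conj_creation (a : ι) :
    particleHole (fun _ : ι => (1 : ℂ)) * creation a * (particleHole (fun _ : ι => (1 : ℂ)))ᴴ =
      annihilation a := by
  rw [particleHole_mul_creation_mul_conjTranspose _ norm_constOne_eq_one, star_one, one_smul]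

/-- `P c†(f) = (Σᵢ fᵢ cᵢ) P`: the particle–hole map turns a smeared creation operator into the
annihilation combination with the SAME (not conjugated) coefficients (reassociated form). [folklore] -/
theorem particleHole_one_mul_create_mul (f : ι → ℂ) (X : Matrix (Finset ι) (Finset ι) ℂ) :
    particleHole (fun _ : ι => (1 : ℂ)) * (create f * X) =
      (∑ i, f i • annihilation i) * (particleHole (fun _ : ι => (1 : ℂ)) * X) := by
  have hPP : (particleHole (fun _ : ι => (1 : ℂ)))ᴴ * particleHole (fun _ : ι => (1 : ℂ)) = 1 :=
    particleHole_conjTranspose_mul _ norm_constOne_eq_one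
  have h : particleHole (fun _ : ι => (1 : ℂ)) * create f *
      (particleHole (fun _ : ι => (1 : ℂ)))ᴴ = ∑ i, f i • annihilation i := by
    simp only [create, Finset.mul_sum, Finset.sum_mul, Matrix.mul_smul, Matrix.smul_mul,
      particleHole_one_conj_creation]
  rw [← Matrix.mul_assoc, ← h, Matrix.mul_assoc _ _ (particleHole _ * X), ← Matrix.mul_assoc _ _ X,
    hPP, Matrix.one_mul]

/-- `Pᴴ c_a = c†_a Pᴴ` (reassociated form of `Pᴴ c_a P = c†_a`). [folklore] -/
theorem particleHole_one_conjTranspose_mul_annihilation_mul (a : ι)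
    (X : Matrix (Finset ι) (Finset ι) ℂ) :
    (particleHole (fun _ : ι => (1 : ℂ)))ᴴ * (annihilation a * X) =
      creation a * ((particleHole (fun _ : ι => (1 : ℂ)))ᴴ * X) := by
  have hPP : (particleHole (fun _ : ι => (1 : ℂ)))ᴴ * particleHole (fun _ : ι => (1 : ℂ)) = 1 :=
    particleHole_conjTranspose_mul _ norm_constOne_eq_one
  rw [← Matrix.mul_assoc, ← particleHole_one_conj_creation a]
  simp only [← Matrix.mul_assoc]
  rw [hPP, Matrix.one_mul]

/-- **Intertwining of `Γ` with annihilation operators**: `Γ(Mᵀ) (Σᵢ M_{ij} cᵢ) = c_j Γ(Mᵀ)` — the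
adjoint of `Γ(g) c†_j = c†(g e_j) Γ(g)` at `g = (Mᵀ)ᴴ` (reassociated form). [folklore] -/
theorem Gamma_transpose_mul_sum_annihilation_mul (M : Matrix ι ι ℂ) (j : ι)
    (X : Matrix (Finset ι) (Finset ι) ℂ) :
    Gamma Mᵀ * ((∑ i, M i j • annihilation i) * X) = annihilation j * (Gamma Mᵀ * X) := by
  have h := congrArg Matrix.conjTranspose (Gamma_mul_creation (Mᵀ)ᴴ j)
  rw [Matrix.conjTranspose_mul, Matrix.conjTranspose_mul, ← Gamma_conjTranspose,
    Matrix.conjTranspose_conjTranspose, creation_conjTranspose, create_conjTranspose] at h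
  have h' : annihilate (fun i => (Mᵀ)ᴴ i j) = ∑ i, M i j • annihilation i := by
    simp only [annihilate, Matrix.conjTranspose_apply, Matrix.transpose_apply, star_star]
  rw [← Matrix.mul_assoc, ← h', ← h, Matrix.mul_assoc]

/-- `P |∅⟩ = |ι⟩`: the particle–hole map sends the vacuum to the completely filled state. [folklore] -/
theorem particleHole_one_mulVec_vacuum :
    particleHole (fun _ : ι => (1 : ℂ)) *ᵥ (vacuum : Fock ι) =
      Pi.single (Finset.univ : Finset ι) (1 : ℂ) := by
  funext t
  rw [particleHole_mulVec_apply, vacuum, Pi.single_apply, Pi.single_apply]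
  by_cases ht : t = univ
  · subst ht
    simp
  · rw [if_neg (fun h => ht ((Finset.compl_eq_empty_iff t).1 h)), if_neg ht, mul_zero]

/-- `Pᴴ |ι⟩ = |∅⟩`. [folklore] -/
theorem particleHole_one_conjTranspose_mulVec_filled :
    (particleHole (fun _ : ι => (1 : ℂ)))ᴴ *ᵥ Pi.single (Finset.univ : Finset ι) (1 : ℂ) =
      (vacuum : Fock ι) := by
  funext t
  rw [particleHole_conjTranspose_mulVec_apply, vacuum, Pi.single_apply, Pi.single_apply]
  by_cases ht : t = ∅
  · subst ht
    simp
  · rw [if_neg (fun h => ht ((Finset.compl_eq_univ_iff t).1 h)), if_neg ht, mul_zero]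

/-- `Γ(Mᵀ)|ι⟩ = det M · |ι⟩` (top exterior power). [folklore] -/
theorem Gamma_transpose_mulVec_filled (M : Matrix ι ι ℂ) :
    Gamma Mᵀ *ᵥ Pi.single (Finset.univ : Finset ι) (1 : ℂ) =
      M.det • Pi.single (Finset.univ : Finset ι) (1 : ℂ) := by
  rw [← fockLift_eq_Gamma',
    RobustYangMillsHandover.PinTheInfimum.FilledSliceState.fockLift_mulVec_filled, Matrix.det_transpose]

/-- **`P Γ(M) Pᴴ = det M · Γ(M⁻ᵀ)`** for invertible `M` and `P = particleHole 1`, via the cyclicity of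
the vacuum applied to `Z = (det M)⁻¹ Pᴴ Γ(Mᵀ) P Γ(M)`. [folklore] -/
theorem particleHole_one_conj_Gamma {M : Matrix ι ι ℂ} (hM : IsUnit M.det) :
    particleHole (fun _ : ι => (1 : ℂ)) * Gamma M * (particleHole (fun _ : ι => (1 : ℂ)))ᴴ =
      M.det • Gamma (M⁻¹)ᵀ := by
  set P : Matrix (Finset ι) (Finset ι) ℂ := particleHole (fun _ : ι => (1 : ℂ)) with hP
  have hd : M.det ≠ 0 := hM.ne_zero
  have hPP' : P * Pᴴ = 1 := particleHole_mul_conjTranspose _ norm_constOne_eq_one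
  have hG : Gamma (M⁻¹)ᵀ * Gamma Mᵀ = 1 := by
    rw [← Gamma_mul, ← Matrix.transpose_mul, Matrix.mul_nonsing_inv M hM, Matrix.transpose_one,
      Gamma_one]
  -- the cyclicity of the vacuum
  have hc : ∀ j, (M.det)⁻¹ • (Pᴴ * Gamma Mᵀ * P * Gamma M) * creation j =
      creation j * ((M.det)⁻¹ • (Pᴴ * Gamma Mᵀ * P * Gamma M)) := by
    intro j
    simp only [Matrix.smul_mul, Matrix.mul_smul, Matrix.mul_assoc]
    rw [Gamma_mul_creation, hP, particleHole_one_mul_create_mul,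
      Gamma_transpose_mul_sum_annihilation_mul, particleHole_one_conjTranspose_mul_annihilation_mul]
  have hv : ((M.det)⁻¹ • (Pᴴ * Gamma Mᵀ * P * Gamma M)) *ᵥ (vacuum : Fock ι) = vacuum := by
    rw [Matrix.smul_mulVec, ← Matrix.mulVec_mulVec, ← Matrix.mulVec_mulVec, ← Matrix.mulVec_mulVec,
      Gamma_mulVec_vacuum, hP, particleHole_one_mulVec_vacuum, Gamma_transpose_mulVec_filled,
      Matrix.mulVec_smul, particleHole_one_conjTranspose_mulVec_filled, smul_smul,
      inv_mul_cancel₀ hd, one_smul]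
  have key : Pᴴ * Gamma Mᵀ * P * Gamma M = M.det • (1 : Matrix (Finset ι) (Finset ι) ℂ) :=
    (inv_smul_eq_iff₀ hd).1 (eq_one_of_commute_creation_of_mulVec_vacuum _ hc hv)
  calc P * Gamma M * Pᴴ = Gamma (M⁻¹)ᵀ * P * (Pᴴ * Gamma Mᵀ * P * Gamma M) * Pᴴ := by
        simp only [← Matrix.mul_assoc]
        rw [Matrix.mul_assoc (Gamma (M⁻¹)ᵀ) P Pᴴ, hPP', Matrix.mul_one, hG, Matrix.one_mul]
    _ = M.det • Gamma (M⁻¹)ᵀ := by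
        rw [key, Matrix.mul_smul, Matrix.mul_one, Matrix.smul_mul, Matrix.mul_assoc, hPP',
          Matrix.mul_one]

end StubFockLiftComplement

/-- **Sub-goal Q2b₂ (registered stub `stub_fockLift_complement`; abstract): particle–hole conjugation of
the Fock functor.**  On the Fock space `Finset ι → ℂ` of finitely many modes there is a unitary `P_h`
supported on complements (`(P_h)_{t s} = 0` unless `t = sᶜ`) with `P_h Γ(M) P_hᴴ = det M · Γ((M⁻¹)ᵀ)`
for every invertible one-particle matrix `M` (`Γ = fockLift`, minors): the exterior-algebra identity
`⋆ Λ^k(M) ⋆⁻¹ = det M · Λ^{n−k}(M⁻ᵀ)` (Jacobi's complementary-minor theorem).  Witness: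
`P_h = particleHole 1` (`|s⟩ ↦ ±|sᶜ⟩`); proof by the cyclicity of the Fock vacuum
(`StubFockLiftComplement.particleHole_one_conj_Gamma`). [folklore] -/
theorem stub_fockLift_complement : ∀ (ι : Type) [LinearOrder ι] [Fintype ι],
    ∃ Ph : Matrix (Finset ι) (Finset ι) ℂ, Ph ∈ Matrix.unitaryGroup (Finset ι) ℂ ∧
      (∀ s t : Finset ι, t ≠ sᶜ → Ph t s = 0) ∧
      ∀ M : Matrix ι ι ℂ, IsUnit M.det → Ph * fockLift M * Phᴴ = M.det • fockLift (M⁻¹)ᵀ := by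
  intro ι _ _
  refine ⟨particleHole (fun _ : ι => (1 : ℂ)),
    particleHole_mem_unitaryGroup_holds _ StubFockLiftComplement.norm_constOne_eq_one,
    fun s t hts => by rw [particleHole_apply, if_neg hts], fun M hM => ?_⟩
  rw [fockLift_eq_Gamma', fockLift_eq_Gamma']
  exact StubFockLiftComplement.particleHole_one_conj_Gamma hM

end Summit.QuantumFields.QCD.Cruxes.StableActionBridge.TwistedTraceTransfer
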